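import Summits.FinalStateConjecture.FinalStateConjecture.Theorems.ZeroEnergyKerrOrBombStationaryLimitReductionRecutCoveringJunctionCore
import Summits.FinalStateConjecture.FinalStateConjecture.Theorems.ZeroEnergyKerrOrBombStationaryLimitReductionStubChartTransfer
import Summits.FinalStateConjecture.FinalStateConjecture.Theorems.ZeroEnergyKerrOrBombStationaryLimitReductionRecutSets
import Summits.FinalStateConjecture.FinalStateConjecture.Theorems.ZeroEnergyKerrOrBombStationaryLimitReductionKerrIsometryRigidityWave3EndTopology
import Literature.Geometry.Lorentzian.CausalFutureProofs
import Literature.Geometry.Lorentzian.MinkowskiGlobalHyperbolicity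
import HarnessLib

/-!
# Route ZeroEnergyKerrOrBomb · crux `FinalStateFromKerrOrBomb` (stmt-FinalStateConjecture-17839), line `SketchIdeator1` —
# stub `stub_recutJunctionCoreB` (m5, boost-honest), wave 7, brick NH′: the NEAR-HORIZON residual (NH), WITHOUT isochrony

Helper file (`--supports stmt-FinalStateConjecture-17839`; registered helper `recutJunction_nearHorizon_of_timeFunction_boost`)
of the lead's wave-7 stub worker W20 (2026-08-17); report `work/stubs/W20-report.md`. It re-proves the wave-5 brick
`recutJunction_nearHorizon_of_timeFunction` (p149108) boost-generally, as planned by the wave-6 boost audit (W17 §4.3(3), §7.3):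
the isochrony hypothesis `Λᵢ e₀ = e₀` is REMOVED and the m4 no-double-coordinate clause (b) is replaced by the certified clause
(b_R) of `HasExhaustiveDocChartsB`; all other hypotheses (radii `Rᵢ → ∞`, Kerr identifications with `cᵢ = 1`, horizon
normalisation, collar clause (n′), ingredient (α) in the p141985 form, time-function property (HTF) in the p149111 form) and
the conclusion are those of p149108 VERBATIM.

Route. For the near-horizon point `p₀ = ψᵢ(Pᵢ Θᵢ x₀)` (`r(x₀) < r₊ + δ₀`, `x₀⁰ < τ₁`) the CLOSED Kerr–Schild box
`K = {r₊ ≤ r ≤ r₊ + δ₀, Tₛ ≤ t* ≤ τ₁}` is compact, so the LAB time `(Pᵢ Θᵢ x)⁰` of its coordinates is bounded by some `Bσ`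
(continuity of `Θᵢ`; the only change w.r.t. p149108, where isochrony gave `(Pᵢ Θᵢ x)⁰ = (Θᵢ x)⁰ + cᵢ⁰`; for a boost `Bσ` is
the Lorentz-sandwich bound of W17 §4.3(3) / p152127 — only its finiteness is used). Horizon normalisation gives a future causal
curve `γ` from `p₀` to a flat slab point `Ψ₀ z` of lab time `σ > max(Bσ, τ₀)`. Box coordinates are rest-late AND certified
(`Aᵢ.radius ≤ r + L ≤ r₊ + 1 + L ≤ Rᵢ` eventually), so by (b_R) a box chart point equal to `Ψ₀ z` would have lab time
`σ ≤ Bσ`: impossible. The rest is p149108's exit argument: `s₁ := sup` of the parameters up to which `γ` runs in the (open,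
`isLateChart_recut`) image of the open box; `γ s₁ = ψᵢ Pᵢ Θᵢ x̄`, `x̄ ∈ K`, `t*(x̄) ≥ t*(x₀)` by (HTF); `r(x̄) = r₊` is a late
collar image below the radiation zone — excluded by (n′); `t*(x̄) = τ₁` is a recut slab point above `p₀`; `r(x̄) = r₊ + δ₀`
is steered by (α); otherwise `s₁ = b` and `Ψ₀ z` would be a box chart point. Elementary; nothing restated; private copies
(suffix `_w7`) from the accepted but unbuilt module …RecutCoreCONearHorizon. Reference: Dafermos–Luk arXiv:1710.01722,
Conjecture 1 (b)–(c); O'Neill 1983, Ch. 14, pp. 402–403.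
-/

set_option linter.dupNamespace false

noncomputable section

open scoped Manifold ContDiff Topology
open Set Filter Function

namespace Summit.FinalStateConjecture.FinalStateConjecture.Theorems.SymplecticDualOfTheBomb

open Literature.Geometry.Lorentzian Summit.FinalStateConjecture.FinalStateConjecture.Theorems.OneLockedExplosion

section NearHorizonBoost

variable {𝓢 : Spacetime.{0} 4} {O : Set 𝓢.carrier} {k : ℕ}

/-- Private copy of `causalPast_subset_causalPast_of_subset` (…RecutJunctionCore, unbuilt today): transitivity of `J⁻` for
sets. O'Neill 1983, Ch. 14, p. 402. [folklore] -/
private theorem causalPast_trans_w7 {S T : Set 𝓢.carrier} (hT : T ⊆ 𝓢.metric.causalPast 𝓢.timeOrientation S) :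
    𝓢.metric.causalPast 𝓢.timeOrientation T ⊆ 𝓢.metric.causalPast 𝓢.timeOrientation S := fun p hp ↦ by
  have h : p ∈ 𝓢.metric.causalFuture 𝓢.timeOrientation.reverse (𝓢.metric.causalFuture 𝓢.timeOrientation.reverse S) :=
    LorentzianMetric.causalFuture_mono hT hp
  rwa [LorentzianMetric.causalFuture_causalFuture_eq (WithTop.coe_le_coe.mpr le_top) S] at h

/-- Private copy (…RecutCoreCONearHorizon, unbuilt today): a point of a future causal curve precedes later ones. [folklore] -/
private theorem mem_causalPast_of_curve_w7 {γ : ℝ → 𝓢.carrier} {a b : ℝ}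
    (hγ : 𝓢.metric.IsFutureCausalCurveOn 𝓢.timeOrientation γ (Icc a b)) {s t : ℝ} (hs : a ≤ s) (hst : s ≤ t) (ht : t ≤ b) :
    γ s ∈ 𝓢.metric.causalPast 𝓢.timeOrientation {γ t} := by
  rcases hst.eq_or_lt with rfl | hlt
  · exact LorentzianMetric.subset_causalPast _ _ _ (mem_singleton _)
  · exact LorentzianMetric.mem_causalPast_singleton_iff.2 (Or.inr ⟨γ s, mem_singleton _, γ, s, t, hlt,
      hγ.mono (Icc_subset_Icc hs ht), rfl, rfl⟩)

/-- Private copy (…RecutCoreCONearHorizon, unbuilt today): `‖x_{space}‖ ≤ r(x) + |a|` on `{r > 0}`. [folklore] -/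
private theorem spatialNorm_le_radius_add_w7 {a : ℝ} {x : E4} (hx : 0 < Kerr.radius a x) :
    E4.spatialNorm x ≤ Kerr.radius a x + |a| := by
  have h := Kerr.norm_le_radius_add_abs (a := a) (y := E4.spatial x) (by rwa [Kerr.radius_ofTimeSpace_spatial])
  rwa [Kerr.radius_ofTimeSpace_spatial] at h

variable (d : StationaryFinalStateDecomposition 𝓢 O k) {M a c r₀ : Fin d.N → ℝ} {Θ : Fin d.N → E4 → E4}

/-- Private copy of `isOpen_image_chart_kerr` (…RecutCoreCONearHorizon, p149108, unbuilt today): **the image of a late open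
Kerr–Schild set under `ψᵢ ∘ Pᵢ ∘ Θᵢ` is open** (`isLateChart_recut`: an open embedding of the late region). [folklore] -/
private theorem isOpen_image_chart_kerr_w7 {i : Fin d.N}
    (hW : IsKerrChartedWith (d.hole i) (d.adapted i) (M i) (a i) (c i) (r₀ i) (Θ i)) {L : ℝ}
    (hL : ∀ u ∈ (Kerr.exterior (M i) (a i) : Set E4), |Θ i u 0 - c i * u 0| ≤ L) {S : Set E4} (hS : IsOpen S)
    (hSext : S ⊆ (Kerr.exterior (M i) (a i) : Set E4)) (hSlate : ∀ x ∈ S, (d.toOver.τ₀ + L) / c i < x 0)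
    (Φ : E4 → 𝓢.carrier) (hΦ : ∀ x ∈ S, ∀ h₀ : ((d.motion i).1 : E4 ≃L[ℝ] E4) (Θ i x) + (d.motion i).2 ∈ (d.background i).domain,
      Φ x = d.toOver.chart i ⟨((d.motion i).1 : E4 ≃L[ℝ] E4) (Θ i x) + (d.motion i).2, h₀⟩) : IsOpen (Φ '' S) := by
  obtain ⟨hsub, hc, -, hr₀, hΘs, hinj, hΘm, -, hiso, -⟩ := hW
  set Λ : lorentzGroup := (d.motion i).1 with hΛ; set c₀ : E4 := (d.motion i).2 with hc₀
  have hsubreg : (Kerr.exterior (M i) (a i) : Set E4) ⊆ (Kerr.region (a i) (r₀ i) : Set E4) := fun z hz ↦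
    Kerr.mem_region.2 ((max_le_max hr₀.le le_rfl).trans_lt (Kerr.mem_exterior.1 hz))
  have hmaps : MapsTo (recutMap Λ c₀ (Θ i)) ((recutBackground d M a i).domain : Set E4)
      ((d.background i).domain : Set E4) := fun z hz ↦ by
    show poincareInv Λ c₀ ((Λ : E4 ≃L[ℝ] E4) (Θ i (poincareInv Λ c₀ z)) + c₀) ∈ ((d.adapted i).domain : Set E4)
    rw [poincareInv_apply_add]; exact hΘm (hsubreg (mem_boostedKerrExterior.1 hz))
  set τ' : ℝ := (d.toOver.τ₀ + L) / c i with hτ'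
  have htilt : ∀ u ∈ (Kerr.exterior (M i) (a i) : Set E4), τ' < u 0 → d.toOver.τ₀ < Θ i u 0 := fun u hu hu0 ↦ by
    have h1 := (abs_le.1 (hL u hu)).1
    have h2 : d.toOver.τ₀ + L < c i * u 0 := by rw [hτ', div_lt_iff₀ hc] at hu0; linarith
    linarith
  set ψ' : (recutBackground d M a i).domain → 𝓢.carrier := fun y ↦ d.toOver.chart i ⟨recutMap Λ c₀ (Θ i) y.1, hmaps y.2⟩
    with hψ'
  have himg : ψ' '' (recutBackground d M a i).lateRegion τ' ⊆ O := by
    rintro _ ⟨y, hy, rfl⟩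
    refine (d.toOver.isLateChart i).image_subset ⟨⟨_, hmaps y.2⟩, ?_, rfl⟩
    show d.toOver.τ₀ < (poincareInv Λ c₀ ((Λ : E4 ≃L[ℝ] E4) (Θ i (poincareInv Λ c₀ y.1)) + c₀)) 0
    rw [poincareInv_apply_add]; exact htilt _ (mem_boostedKerrExterior.1 y.2) hy
  have hlate : 𝓢.IsLateChart (recutBackground d M a i) O τ' ψ' :=
    isLateChart_recut (d.adapted i) Λ c₀ (d.toOver.isLateChart i) hr₀.le hΘs hinj hiso hmaps htilt himg
  set U : Set ((recutBackground d M a i).lateRegion τ') := {w | poincareInv Λ c₀ (w.1 : E4) ∈ S} with hU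
  have hUo : IsOpen U :=
    hS.preimage ((continuous_poincareInv Λ c₀).comp (continuous_subtype_val.comp continuous_subtype_val))
  have heq : Φ '' S = ((recutBackground d M a i).lateRegion τ').restrict ψ' '' U := by
    apply Subset.antisymm
    · rintro _ ⟨x, hx, rfl⟩
      have hzdom : (Λ : E4 ≃L[ℝ] E4) x + c₀ ∈ (recutBackground d M a i).domain := by
        show poincareInv Λ c₀ _ ∈ (Kerr.exterior (M i) (a i) : Set E4)
        rw [poincareInv_apply_add]; exact hSext hx
      have hzlate : (⟨_, hzdom⟩ : (recutBackground d M a i).domain) ∈ (recutBackground d M a i).lateRegion τ' := by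
        show τ' < (poincareInv Λ c₀ ((Λ : E4 ≃L[ℝ] E4) x + c₀)) 0
        rw [poincareInv_apply_add]; exact hSlate x hx
      refine ⟨⟨_, hzlate⟩, ?_, ?_⟩
      · show poincareInv Λ c₀ ((Λ : E4 ≃L[ℝ] E4) x + c₀) ∈ S
        rw [poincareInv_apply_add]; exact hx
      · have hrm : recutMap Λ c₀ (Θ i) ((Λ : E4 ≃L[ℝ] E4) x + c₀) = (Λ : E4 ≃L[ℝ] E4) (Θ i x) + c₀ := by
          show (Λ : E4 ≃L[ℝ] E4) (Θ i (poincareInv Λ c₀ ((Λ : E4 ≃L[ℝ] E4) x + c₀))) + c₀ = _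
          rw [poincareInv_apply_add]
        have key : ∀ (v : E4) (hv : v ∈ (d.background i).domain), v = (Λ : E4 ≃L[ℝ] E4) (Θ i x) + c₀ →
            d.toOver.chart i ⟨v, hv⟩ = Φ x := by
          rintro v hv rfl; exact (hΦ x hx hv).symm
        exact key _ (hmaps hzdom) hrm
    · rintro _ ⟨w, hw, rfl⟩
      have hx : poincareInv Λ c₀ (w.1 : E4) ∈ S := hw
      refine ⟨_, hx, ?_⟩
      rw [hΦ _ hx (hmaps w.1.2)]
      rfl
  rw [heq]
  exact hlate.isOpenEmbedding.isOpenMap U hUo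

set_option maxHeartbeats 400000 in
/-- **Registered helper `recutJunction_nearHorizon_of_timeFunction_boost`** (brick NH′ of the m5 core, W17 §7.3) — the
near-horizon residual (NH) of the junction core, BOOST-GENERALLY: from `cᵢ = 1`, `Rᵢ → ∞`, horizon normalisation, the
certified clause (b_R) of `HasExhaustiveDocChartsB`, the collar clause (n′), ingredient (α) (p141985 form) and (HTF) (p149111
form); no isochrony (the lab time of the chart coordinates of the compact Kerr–Schild box is bounded, and the comparison
flat point is chosen lab-later). Conclusion: the (NH) text of p149108 verbatim. [folklore] -/
theorem recutJunction_nearHorizon_of_timeFunction_boost : ∀ {𝓢 : Spacetime.{0} 4} {O : Set 𝓢.carrier} {k : ℕ} (d : StationaryFinalStateDecomposition 𝓢 O k) (M a c r₀ : Fin d.N → ℝ) (Θ : Fin d.N → E4 → E4) (R : Fin d.N → ℝ → ℝ), (∀ i, Tendsto (R i) atTop atTop) → (∀ i, IsKerrChartedWith (d.hole i) (d.adapted i) (M i) (a i) (c i) (r₀ i) (Θ i)) → (∀ i, c i = 1) → IsHorizonNormalised d → (∀ (i : Fin d.N) (y : (d.background i).domain) (y' : d.toOver.flatDomain), d.toOver.τ₀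 < (d.background i).time y.1 → (d.background i).radius y.1 ≤ R i ((d.background i).time y.1) → d.toOver.τ₀ < (y' : E4) 0 → d.toOver.chart i y = d.toOver.flatChart y' → (y : E4) = y') → (∀ (i : Fin d.N) (x : (d.background i).domain), x ∈ (d.background i).lateRegion d.toOver.τ₀ → x ∉ docPart d i → d.toOver.chart i x ∉ 𝓢.metric.causalPast 𝓢.timeOrientation d.toOver.radiationZone) → (∀ (i : Fin d.N) (δ : ℝ), 0 < δ → ∃ T : ℝ, ∀ (R' : Fin d.N → ℝ → ℝ) (τ₁ : ℝ), ∀ x ∈ (Kerr.exterior (M i) (a i) : Set E4), Kerr.rPlus (M i) (a i) + δ ≤ Kerr.radius (a i) x → T ≤ Θ i x 0 → (d.adapted i).radius (Θ i x) ≤ R i (Θ i x 0) → x 0 ≤ τ₁ → Kerr.radius (a i) x ≤ R' i τ₁ → ∀ h₀ : ((d.motion i).1 : E4 ≃L[ℝ] E4) (Θ i x) + (d.motion i).2 ∈ (d.background i).domain, d.toOver.chart i ⟨((d.motion i).1 : E4 ≃L[ℝ] E4) (Θ i x) + (d.motion i).2, h₀⟩ ∈ 𝓢.metric.causalPast 𝓢.timeOrientation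 (recutCertifiedSlab d M a Θ R' τ₁)) → (∀ i : Fin d.N, ∃ T₁ δ₀ : ℝ, 0 < δ₀ ∧ ∀ (γ : ℝ → 𝓢.carrier) (a' b' : ℝ), 𝓢.metric.IsFutureCausalCurveOn 𝓢.timeOrientation γ (Set.Icc a' b') → (∀ s ∈ Set.Icc a' b', ∃ x ∈ (Kerr.exterior (M i) (a i) : Set E4), T₁ ≤ x 0 ∧ Kerr.radius (a i) x ≤ Kerr.rPlus (M i) (a i) + δ₀ ∧ ∃ h₀ : ((d.motion i).1 : E4 ≃L[ℝ] E4) (Θ i x) + (d.motion i).2 ∈ (d.background i).domain, d.toOver.chart i ⟨((d.motion i).1 : E4 ≃L[ℝ] E4) (Θ i x) + (d.motion i).2, h₀⟩ = γ s) → ∀ s ∈ Set.Icc a' b', ∀ t ∈ Set.Icc a' b', s ≤ t → ∀ x ∈ (Kerr.exterior (M i) (a i) : Set E4), ∀ x' ∈ (Kerr.exterior (M i) (a i) : Set E4), T₁ ≤ x 0 → T₁ ≤ x' 0 → (∃ h₀ : ((d.motion i).1 : E4 ≃L[ℝ] E4) (Θ i x) + (d.motion i).2 ∈ (d.background i).domain,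 d.toOver.chart i ⟨((d.motion i).1 : E4 ≃L[ℝ] E4) (Θ i x) + (d.motion i).2, h₀⟩ = γ s) → (∃ h₀' : ((d.motion i).1 : E4 ≃L[ℝ] E4) (Θ i x') + (d.motion i).2 ∈ (d.background i).domain, d.toOver.chart i ⟨((d.motion i).1 : E4 ≃L[ℝ] E4) (Θ i x') + (d.motion i).2, h₀'⟩ = γ t) → x 0 ≤ x' 0) → ∀ i : Fin d.N, ∃ δ T : ℝ, 0 < δ ∧ ∀ (R' : Fin d.N → ℝ → ℝ) (τ₁ : ℝ), ∀ x ∈ (Kerr.exterior (M i) (a i) : Set E4), Kerr.radius (a i) x < Kerr.rPlus (M i) (a i) + δ → T ≤ Θ i x 0 → (d.adapted i).radius (Θ i x) ≤ R i (Θ i x 0) → x 0 ≤ τ₁ → Kerr.rPlus (M i) (a i) + 1 ≤ R' i τ₁ → ∀ h₀ : ((d.motion i).1 : E4 ≃L[ℝ] E4) (Θ i x) + (d.motion i).2 ∈ (d.background i).domain, d.toOver.chart i ⟨((d.motion i).1 : E4 ≃L[ℝ] E4) (Θ i x) + (d.motion i).2, h₀⟩ ∈ 𝓢.metric.causalPast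 𝓢.timeOrientation (recutCertifiedSlab d M a Θ R' τ₁) := by
  intro 𝓢 O k d M a c r₀ Θ R hRtop hW hc1 hnorm hb hn' hα hTF i
  classical
  have hWi := hW i
  obtain ⟨hsub, hc, -, hr₀, hΘs, hinj, hΘm, hΘe, -, hanchor, -⟩ := hW i
  set Λ : lorentzGroup := (d.motion i).1 with hΛ; set c₀ : E4 := (d.motion i).2 with hc₀
  have hrp : 0 < Kerr.rPlus (M i) (a i) := hsub.pos.trans_le (le_add_of_nonneg_right (Real.sqrt_nonneg _))
  have hsubreg : (Kerr.exterior (M i) (a i) : Set E4) ⊆ (Kerr.region (a i) (r₀ i) : Set E4) := fun z hz ↦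
    Kerr.mem_region.2 ((max_le_max hr₀.le le_rfl).trans_lt (Kerr.mem_exterior.1 hz))
  have hregion : ∀ x : E4, Kerr.rPlus (M i) (a i) ≤ Kerr.radius (a i) x → x ∈ (Kerr.region (a i) (r₀ i) : Set E4) :=
    fun x hx ↦ Kerr.mem_region.2 ((max_lt hr₀ hrp).trans_le hx)
  have hdomx : ∀ x ∈ (Kerr.region (a i) (r₀ i) : Set E4),
      (Λ : E4 ≃L[ℝ] E4) (Θ i x) + c₀ ∈ (d.background i).domain := fun x hx ↦ by
    show poincareInv Λ c₀ _ ∈ ((d.adapted i).domain : Set E4)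
    rw [poincareInv_apply_add]; exact hΘm hx
  obtain ⟨L₁, hL₁0, hL₁⟩ := kerrChartedWith_global_bounds hWi
  have htilt' : ∀ u ∈ (Kerr.exterior (M i) (a i) : Set E4), |Θ i u 0 - c i * u 0| ≤ L₁ := fun u hu ↦ (hL₁ u hu).1
  have htilt : ∀ u ∈ (Kerr.exterior (M i) (a i) : Set E4), |Θ i u 0 - u 0| ≤ L₁ := fun u hu ↦ by
    have h := (hL₁ u hu).1; rwa [hc1 i, one_mul] at h
  obtain ⟨T₁, δ₁, hδ₁, hTF⟩ := hTF i
  set δ₀ : ℝ := min δ₁ 1 with hδ₀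
  have hδ₀0 : 0 < δ₀ := lt_min hδ₁ zero_lt_one; have hδ₀1 : δ₀ ≤ 1 := min_le_right _ _; have hδ₀δ₁ : δ₀ ≤ δ₁ := min_le_left _ _
  obtain ⟨Tα, hTα⟩ := hα i δ₀ hδ₀0
  obtain ⟨TR, hTR⟩ := eventually_atTop.1 ((hRtop i).eventually_ge_atTop (Kerr.rPlus (M i) (a i) + 1 + L₁))
  set T : ℝ := max (max T₁ Tα) (max TR (d.toOver.τ₀ + L₁)) with hT
  have hTT₁ : T₁ ≤ T := (le_max_left _ _).trans (le_max_left _ _); have hTTα : Tα ≤ T := (le_max_right _ _).trans (le_max_left _ _)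
  have hTTR : TR ≤ T := (le_max_left _ _).trans (le_max_right _ _); have hTτ₀ : d.toOver.τ₀ + L₁ ≤ T := le_max_of_le_right (le_max_right _ _)
  refine ⟨δ₀, T + 2 * L₁ + 2, hδ₀0, fun R' τ₁ x₀ hx₀ hx₀r hx₀T hx₀R hx₀τ hR'1 h₀ ↦ ?_⟩
  have hx₀t := abs_le.1 (htilt x₀ hx₀)
  have hx₀0 : T + L₁ + 2 ≤ x₀ 0 := by linarith [hx₀t.2]
  set Ts : ℝ := T + L₁ + 1 with hTs
  -- near-horizon Kerr–Schild points of time `≥ Ts` have CERTIFIED chart coordinates (`Rᵢ → ∞`)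
  have hcertKS : ∀ x ∈ (Kerr.exterior (M i) (a i) : Set E4), Kerr.radius (a i) x ≤ Kerr.rPlus (M i) (a i) + δ₀ →
      Ts ≤ x 0 → (d.adapted i).radius (Θ i x) ≤ R i (Θ i x 0) := fun x hx hxr hxT ↦ by
    have hxt := abs_le.1 (htilt x hx)
    have h1 := (hL₁ x hx).2.1
    linarith [hTR (Θ i x 0) (by linarith)]
  have slabmem : ∀ x ∈ (Kerr.exterior (M i) (a i) : Set E4), x 0 = τ₁ → Kerr.radius (a i) x ≤ R' i τ₁ →
      ∀ h : (Λ : E4 ≃L[ℝ] E4) (Θ i x) + c₀ ∈ (d.background i).domain,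
      d.toOver.chart i ⟨(Λ : E4 ≃L[ℝ] E4) (Θ i x) + c₀, h⟩ ∈ recutCertifiedSlab d M a Θ R' τ₁ := by
    intro x hx hx0 hxr h
    set z : E4 := (Λ : E4 ≃L[ℝ] E4) x + c₀ with hz
    have hPz : poincareInv Λ c₀ z = x := poincareInv_apply_add _ _ _
    have hzdom : z ∈ ((recutBackground d M a i).domain : Set E4) := by
      show poincareInv Λ c₀ z ∈ (Kerr.exterior (M i) (a i) : Set E4); rw [hPz]; exact hx
    refine Or.inr (mem_iUnion.2 ⟨i, mem_image_of_mem _ ?_⟩)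
    refine ⟨z, ⟨⟨z, hzdom⟩, ⟨?_, ?_⟩, rfl⟩, ?_⟩
    · show (poincareInv Λ c₀ z) 0 = τ₁; rw [hPz]; exact hx0
    · show Kerr.radius (a i) (poincareInv Λ c₀ z) ≤ R' i τ₁; rw [hPz]; exact hxr
    · show (Λ : E4 ≃L[ℝ] E4) (Θ i (poincareInv Λ c₀ z)) + c₀ = _; rw [hPz]
  set p₀ := d.toOver.chart i ⟨(Λ : E4 ≃L[ℝ] E4) (Θ i x₀) + c₀, h₀⟩ with hp₀
  rcases hx₀τ.eq_or_lt with hx₀eq | hx₀lt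
  · exact LorentzianMetric.subset_causalPast _ _ _ (slabmem x₀ hx₀ hx₀eq (by linarith) h₀)
  -- the CLOSED near-horizon Kerr–Schild box is compact, and the lab time of its chart coordinates is bounded (NEW, m5)
  have h0c : Continuous fun x : E4 ↦ x 0 := (EuclideanSpace.proj (𝕜 := ℝ) (0 : Fin 4)).continuous
  set Kbox : Set E4 := {x | Kerr.rPlus (M i) (a i) ≤ Kerr.radius (a i) x ∧ Kerr.radius (a i) x ≤ Kerr.rPlus (M i) (a i) + δ₀ ∧
    Ts ≤ x 0 ∧ x 0 ≤ τ₁} with hKbox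
  have hKreg : Kbox ⊆ (Kerr.region (a i) (r₀ i) : Set E4) := fun x hx ↦ hregion x hx.1
  have hKc : IsCompact Kbox := by
    refine Metric.isCompact_of_isClosed_isBounded ?_ ((Metric.isBounded_closedBall (x := (0 : E4))
      (r := |Ts| + |τ₁| + (Kerr.rPlus (M i) (a i) + 1 + |a i|))).subset fun x hx ↦ ?_)
    · rw [hKbox, setOf_and, setOf_and, setOf_and]
      exact (isClosed_le continuous_const (Kerr.continuous_radius _)).inter ((isClosed_le (Kerr.continuous_radius _)
        continuous_const).inter ((isClosed_le continuous_const h0c).inter (isClosed_le h0c continuous_const)))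
    · obtain ⟨h1, h2, h3, h4⟩ := hx
      rw [Metric.mem_closedBall, dist_zero_right]
      have hsp := spatialNorm_le_radius_add_w7 (hrp.trans_le h1)
      have ht : |x 0| ≤ |Ts| + |τ₁| := by
        rw [abs_le]; constructor <;> linarith [le_abs_self τ₁, neg_abs_le Ts, abs_nonneg Ts, abs_nonneg τ₁]
      refine (pow_le_pow_iff_left₀ (norm_nonneg _) (by positivity) two_ne_zero).1 ?_
      rw [E4.norm_sq_eq_time_sq_add x]
      nlinarith [abs_nonneg (x 0), E4.spatialNorm_nonneg x, sq_abs (x 0), abs_nonneg Ts, abs_nonneg τ₁,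
        abs_nonneg (a i), hrp.le]
  obtain ⟨Bσ, hBσ⟩ : ∃ Bσ : ℝ, ∀ x ∈ Kbox, ((Λ : E4 ≃L[ℝ] E4) (Θ i x) + c₀) 0 ≤ Bσ := by
    obtain ⟨C, hC⟩ := hKc.exists_bound_of_continuousOn (f := fun x ↦ ((Λ : E4 ≃L[ℝ] E4) (Θ i x) + c₀) 0)
      (h0c.comp_continuousOn ((((Λ : E4 ≃L[ℝ] E4).continuous.comp_continuousOn
        (hΘs.continuousOn.mono hKreg)).add continuousOn_const)))
    exact ⟨C, fun x hx ↦ (Real.le_norm_self _).trans (hC x hx)⟩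
  -- horizon normalisation: a future causal curve from `p₀` to a far flat slab point `q`, lab-later than the box
  have hy₀late : (⟨_, h₀⟩ : (d.background i).domain) ∈ (d.background i).lateRegion d.toOver.τ₀ := by
    show d.toOver.τ₀ < (poincareInv Λ c₀ ((Λ : E4 ≃L[ℝ] E4) (Θ i x₀) + c₀)) 0
    rw [poincareInv_apply_add]; linarith [hx₀t.1]
  have hy₀doc : (⟨_, h₀⟩ : (d.background i).domain) ∈ docPart d i := by
    have h : Θ i x₀ ∈ Θ i '' (Kerr.exterior (M i) (a i) : Set E4) := mem_image_of_mem _ hx₀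
    rw [hanchor] at h
    obtain ⟨h1, h2⟩ := h
    show ∃ h : poincareInv Λ c₀ ((Λ : E4 ≃L[ℝ] E4) (Θ i x₀) + c₀) ∈ (d.adapted i).domain, (d.adapted i).toFun ⟨_, h⟩ ∈ (d.hole i).doc
    rw [poincareInv_apply_add]; exact ⟨h1, h2⟩
  set σ₀ : ℝ := max Bσ d.toOver.τ₀ + 1 with hσ₀
  have hσ₀B : Bσ < σ₀ := by rw [hσ₀]; linarith [le_max_left Bσ d.toOver.τ₀]
  have hσ₀τ : d.toOver.τ₀ < σ₀ := by rw [hσ₀]; linarith [le_max_right Bσ d.toOver.τ₀]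
  obtain ⟨σ, hσ, hpσ⟩ := hnorm i ⟨_, h₀⟩ ⟨hy₀late, hy₀doc⟩ σ₀
  obtain ⟨q, hq, hpq⟩ : ∃ q ∈ d.toOver.flatChart '' (Minkowski.backgroundOn d.toOver.flatDomain).timeSlab σ,
      p₀ ∈ 𝓢.metric.causalPast 𝓢.timeOrientation {q} := by
    rcases hpσ with hp | ⟨q, hq, h⟩
    · exact ⟨p₀, hp, LorentzianMetric.subset_causalPast _ _ _ (mem_singleton p₀)⟩
    · exact ⟨q, hq, Or.inr ⟨q, mem_singleton q, h⟩⟩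
  obtain ⟨zq, hzq, rfl⟩ := hq
  have hzq0 : (zq : E4) 0 = σ := hzq
  have hzqlate : d.toOver.τ₀ < (zq : E4) 0 := by rw [hzq0]; linarith
  have hqrad : d.toOver.flatChart zq ∈ d.toOver.radiationZone := mem_image_of_mem _ (show d.toOver.τ₀ < (zq : E4) 0 from hzqlate)
  -- `q` is not a box chart point: box coordinates are rest-late and certified, so by (b_R) `zq` (lab time `σ > Bσ`) = one
  have hqfar : ∀ x ∈ (Kerr.exterior (M i) (a i) : Set E4), Kerr.radius (a i) x ≤ Kerr.rPlus (M i) (a i) + δ₀ →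
      Ts ≤ x 0 → x 0 ≤ τ₁ → ∀ h : (Λ : E4 ≃L[ℝ] E4) (Θ i x) + c₀ ∈ (d.background i).domain,
      d.toOver.chart i ⟨(Λ : E4 ≃L[ℝ] E4) (Θ i x) + c₀, h⟩ ≠ d.toOver.flatChart zq := by
    intro x hx hxr hxT hxτ h heq
    have hxt := abs_le.1 (htilt x hx)
    have hrest : d.toOver.τ₀ < (d.background i).time ((Λ : E4 ≃L[ℝ] E4) (Θ i x) + c₀) := by
      show d.toOver.τ₀ < (poincareInv Λ c₀ ((Λ : E4 ≃L[ℝ] E4) (Θ i x) + c₀)) 0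
      rw [poincareInv_apply_add]; linarith
    have hcert : (d.background i).radius ((Λ : E4 ≃L[ℝ] E4) (Θ i x) + c₀) ≤
        R i ((d.background i).time ((Λ : E4 ≃L[ℝ] E4) (Θ i x) + c₀)) := by
      show (d.adapted i).radius (poincareInv Λ c₀ ((Λ : E4 ≃L[ℝ] E4) (Θ i x) + c₀)) ≤
        R i ((poincareInv Λ c₀ ((Λ : E4 ≃L[ℝ] E4) (Θ i x) + c₀)) 0)
      rw [poincareInv_apply_add]; exact hcertKS x hx hxr hxT
    have hyz := hb i ⟨_, h⟩ zq hrest hcert hzqlate heq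
    have h1 : ((Λ : E4 ≃L[ℝ] E4) (Θ i x) + c₀) 0 = σ := by
      rw [show ((Λ : E4 ≃L[ℝ] E4) (Θ i x) + c₀) = (zq : E4) from hyz]; exact hzq0
    have h2 := hBσ x ⟨(le_max_left _ _).trans (Kerr.mem_exterior.1 hx).le, hxr, hxT, hxτ⟩
    linarith
  obtain ⟨γ, a', b', hab, hγ, hγa, hγb⟩ : ∃ (γ : ℝ → 𝓢.carrier) (a' b' : ℝ), a' < b' ∧
      𝓢.metric.IsFutureCausalCurveOn 𝓢.timeOrientation γ (Icc a' b') ∧ γ a' = p₀ ∧ γ b' = d.toOver.flatChart zq := by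
    rcases LorentzianMetric.mem_causalPast_singleton_iff.1 hpq with h | ⟨p, hp, γ, a', b', hab, hγ, hγa, hγb⟩
    · exact (hqfar x₀ hx₀ hx₀r.le (by linarith) hx₀τ h₀ (mem_singleton_iff.1 h).symm).elim
    · exact ⟨γ, a', b', hab, hγ, by rw [hγa]; exact mem_singleton_iff.1 hp, hγb⟩
  -- the open near-horizon Kerr–Schild box and its (open) chart image `G`
  set Sint : Set E4 := {x | Kerr.rPlus (M i) (a i) < Kerr.radius (a i) x ∧ Kerr.radius (a i) x < Kerr.rPlus (M i) (a i) + δ₀ ∧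
    Ts < x 0 ∧ x 0 < τ₁} with hSint
  have hSext : Sint ⊆ (Kerr.exterior (M i) (a i) : Set E4) := fun x hx ↦ Kerr.mem_exterior.2 ((max_eq_left hrp.le).trans_lt hx.1)
  have hSK : Sint ⊆ Kbox := fun x hx ↦ ⟨hx.1.le, hx.2.1.le, hx.2.2.1.le, hx.2.2.2.le⟩
  have hSo : IsOpen Sint := by
    rw [hSint, setOf_and, setOf_and, setOf_and]
    exact (isOpen_lt continuous_const (Kerr.continuous_radius _)).inter ((isOpen_lt (Kerr.continuous_radius _)
      continuous_const).inter ((isOpen_lt continuous_const h0c).inter (isOpen_lt h0c continuous_const)))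
  obtain ⟨Φ, hΦ⟩ : ∃ Φ : E4 → 𝓢.carrier, ∀ (x : E4) (hx : x ∈ (Kerr.region (a i) (r₀ i) : Set E4)),
      Φ x = d.toOver.chart i ⟨(Λ : E4 ≃L[ℝ] E4) (Θ i x) + c₀, hdomx x hx⟩ :=
    ⟨fun x ↦ if h : (Λ : E4 ≃L[ℝ] E4) (Θ i x) + c₀ ∈ (d.background i).domain then d.toOver.chart i ⟨_, h⟩ else p₀,
      fun x hx ↦ by simp only [dif_pos (hdomx x hx)]⟩
  have hΦ' : ∀ x ∈ (Kerr.region (a i) (r₀ i) : Set E4), ∀ h : (Λ : E4 ≃L[ℝ] E4) (Θ i x) + c₀ ∈ (d.background i).domain,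
      Φ x = d.toOver.chart i ⟨(Λ : E4 ≃L[ℝ] E4) (Θ i x) + c₀, h⟩ := fun x hx h ↦ hΦ x hx
  set G : Set 𝓢.carrier := Φ '' Sint with hG
  have hGo : IsOpen G := isOpen_image_chart_kerr_w7 d hWi htilt' hSo hSext
    (fun x hx ↦ by rw [hc1 i, div_one]; linarith [hx.2.2.1]) Φ (fun x hx h ↦ hΦ' x (hsubreg (hSext hx)) h)
  have hx₀S : x₀ ∈ Sint := ⟨(le_max_left _ _).trans_lt (Kerr.mem_exterior.1 hx₀), hx₀r, by linarith, hx₀lt⟩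
  have hp₀G : γ a' ∈ G := ⟨x₀, hx₀S, by rw [hγa, hΦ' x₀ (hsubreg hx₀) h₀]⟩
  set A : Set ℝ := {s | s ∈ Icc a' b' ∧ ∀ u ∈ Icc a' s, γ u ∈ G} with hA
  have haA : a' ∈ A := ⟨⟨le_rfl, hab.le⟩, fun u hu ↦ by rw [le_antisymm hu.2 hu.1]; exact hp₀G⟩
  have hAbdd : BddAbove A := ⟨b', fun s hs ↦ hs.1.2⟩
  have hAne : A.Nonempty := ⟨a', haA⟩
  set s₁ : ℝ := sSup A with hs₁
  have hs₁I : s₁ ∈ Icc a' b' := ⟨le_csSup hAbdd haA, csSup_le hAne fun s hs ↦ hs.1.2⟩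
  have hAint : ∀ s ∈ A, ∀ u ∈ Icc a' s, u ∈ A := fun s hs u hu ↦
    ⟨⟨hu.1, hu.2.trans hs.1.2⟩, fun v hv ↦ hs.2 v ⟨hv.1, hv.2.trans hu.2⟩⟩
  have hbelow : ∀ s ∈ Ico a' s₁, s ∈ A := fun s hs ↦ by
    obtain ⟨s'', hs'', hlt⟩ := exists_lt_of_lt_csSup hAne hs.2
    exact hAint s'' hs'' s ⟨hs.1, hlt.le⟩
  have hlift : ∀ s ∈ A, ∀ u ∈ Icc a' s, ∃ x ∈ (Kerr.exterior (M i) (a i) : Set E4), T₁ ≤ x 0 ∧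
      Kerr.radius (a i) x ≤ Kerr.rPlus (M i) (a i) + δ₁ ∧
      ∃ h : (Λ : E4 ≃L[ℝ] E4) (Θ i x) + c₀ ∈ (d.background i).domain,
        d.toOver.chart i ⟨(Λ : E4 ≃L[ℝ] E4) (Θ i x) + c₀, h⟩ = γ u := fun s hs u hu ↦ by
    obtain ⟨x, hxS, hxu⟩ := hs.2 u hu
    exact ⟨x, hSext hxS, by linarith [hxS.2.2.1], by linarith [hxS.2.1], hdomx x (hsubreg (hSext hxS)),
      by rw [← hΦ' x (hsubreg (hSext hxS))]; exact hxu⟩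
  have hmono : ∀ s ∈ A, ∀ x ∈ (Kerr.exterior (M i) (a i) : Set E4), T₁ ≤ x 0 →
      (∃ h : (Λ : E4 ≃L[ℝ] E4) (Θ i x) + c₀ ∈ (d.background i).domain,
        d.toOver.chart i ⟨(Λ : E4 ≃L[ℝ] E4) (Θ i x) + c₀, h⟩ = γ s) → x₀ 0 ≤ x 0 := fun s hs x hx hxT hxeq ↦
    hTF γ a' s (hγ.mono (Icc_subset_Icc le_rfl hs.1.2)) (hlift s hs) a' ⟨le_rfl, hs.1.1⟩ s ⟨hs.1.1, le_rfl⟩ hs.1.1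
      x₀ hx₀ x hx (by linarith) hxT ⟨h₀, hγa.symm⟩ hxeq
  -- a sequence in `A` tending to `s₁`, its lifts in the box, a limit `x̄ ∈ Kbox` of the lifts (compactness); `γ s₁ = Φ x̄`
  obtain ⟨u, -, hu, huA⟩ := exists_seq_tendsto_sSup hAne hAbdd
  have hux : ∀ n, ∃ x ∈ Sint, Φ x = γ (u n) := fun n ↦ (huA n).2 (u n) ⟨(huA n).1.1, le_rfl⟩
  choose xs hxsS hxsγ using hux
  obtain ⟨xbar, hxbarK, φ, hφ, hconv⟩ := hKc.tendsto_subseq fun n ↦ hSK (hxsS n)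
  obtain ⟨hr1, hr2, -, ht2⟩ := hxbarK
  have htlim : Tendsto (fun n ↦ xs (φ n) 0) atTop (𝓝 (xbar 0)) := (h0c.tendsto xbar).comp hconv
  have ht0 : x₀ 0 ≤ xbar 0 := ge_of_tendsto' htlim fun n ↦ hmono (u (φ n)) (huA (φ n)) (xs (φ n)) (hSext (hxsS (φ n)))
    (by linarith [(hxsS (φ n)).2.2.1]) ⟨hdomx _ (hsubreg (hSext (hxsS (φ n)))), by rw [← hΦ' _ (hsubreg (hSext (hxsS (φ n))))]; exact hxsγ (φ n)⟩
  have hxreg : xbar ∈ (Kerr.region (a i) (r₀ i) : Set E4) := hregion xbar hr1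
  have hΘc : ContinuousAt (Θ i) xbar := (hΘs.continuousOn.continuousWithinAt hxreg).continuousAt
    ((Kerr.region (a i) (r₀ i)).isOpen.mem_nhds hxreg)
  have hΘlim : Tendsto (fun n ↦ Θ i (xs (φ n))) atTop (𝓝 (Θ i xbar)) := hΘc.tendsto.comp hconv
  have hΘ0 : xbar 0 - L₁ ≤ Θ i xbar 0 := by
    have h1 : Tendsto (fun n ↦ Θ i (xs (φ n)) 0 - xs (φ n) 0) atTop (𝓝 (Θ i xbar 0 - xbar 0)) :=
      ((h0c.tendsto _).comp hΘlim).sub htlim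
    have h2 := ge_of_tendsto' h1 fun n ↦ (abs_le.1 (htilt _ (hSext (hxsS (φ n))))).1
    linarith
  have hγs₁ : γ s₁ = d.toOver.chart i ⟨(Λ : E4 ≃L[ℝ] E4) (Θ i xbar) + c₀, hdomx xbar hxreg⟩ := by
    have h1 : Tendsto (fun n ↦ γ (u (φ n))) atTop (𝓝 (γ s₁)) :=
      ((hγ.continuousAt hs₁I).tendsto).comp (hu.comp hφ.tendsto_atTop)
    have h2 : Tendsto (fun n ↦ γ (u (φ n))) atTop (𝓝 (d.toOver.chart i ⟨(Λ : E4 ≃L[ℝ] E4) (Θ i xbar) + c₀, hdomx xbar hxreg⟩)) := by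
      have hY : Tendsto (fun n ↦ (⟨(Λ : E4 ≃L[ℝ] E4) (Θ i (xs (φ n))) + c₀, hdomx _ (hsubreg (hSext (hxsS (φ n))))⟩ :
          (d.background i).domain)) atTop (𝓝 ⟨(Λ : E4 ≃L[ℝ] E4) (Θ i xbar) + c₀, hdomx xbar hxreg⟩) := by
        rw [tendsto_subtype_rng]
        exact (((Λ : E4 ≃L[ℝ] E4).continuous.tendsto _).comp hΘlim).add tendsto_const_nhds
      refine (((d.toOver.isLateChart i).contMDiff.continuous.tendsto _).comp hY).congr fun n ↦ ?_
      show d.toOver.chart i ⟨(Λ : E4 ≃L[ℝ] E4) (Θ i (xs (φ n))) + c₀, hdomx _ (hsubreg (hSext (hxsS (φ n))))⟩ = γ (u (φ n))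
      rw [← hΦ' _ (hsubreg (hSext (hxsS (φ n))))]; exact hxsγ (φ n)
    exact tendsto_nhds_unique h1 h2
  have hs₁q : γ s₁ ∈ 𝓢.metric.causalPast 𝓢.timeOrientation {d.toOver.flatChart zq} := by
    rw [← hγb]; exact mem_causalPast_of_curve_w7 hγ hs₁I.1 hs₁I.2 le_rfl
  have hp₀s₁ : p₀ ∈ 𝓢.metric.causalPast 𝓢.timeOrientation {γ s₁} := by
    rw [← hγa]; exact mem_causalPast_of_curve_w7 hγ le_rfl hs₁I.1 hs₁I.2
  rcases hr1.eq_or_lt with hhor | hext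
  · -- (a) `x̄` on the horizon: `γ s₁` is a late collar image below the radiation zone — excluded by (n′)
    exfalso
    refine hn' i ⟨_, hdomx xbar hxreg⟩ ?_ ?_ ?_
    · show d.toOver.τ₀ < (poincareInv Λ c₀ ((Λ : E4 ≃L[ℝ] E4) (Θ i xbar) + c₀)) 0
      rw [poincareInv_apply_add]; linarith
    · rintro ⟨h1, h2⟩
      have h : poincareInv Λ c₀ ((Λ : E4 ≃L[ℝ] E4) (Θ i xbar) + c₀) ∈ Θ i '' (Kerr.exterior (M i) (a i) : Set E4) := by
        rw [hanchor]; exact ⟨h1, h2⟩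
      rw [poincareInv_apply_add] at h
      obtain ⟨x', hx', hxx⟩ := h
      have heq : x' = xbar := hinj (hsubreg hx') hxreg hxx
      have h3 := Kerr.mem_exterior.1 hx'
      rw [heq, ← hhor, max_eq_left hrp.le] at h3
      exact lt_irrefl _ h3
    · have h := LorentzianMetric.causalFuture_mono (singleton_subset_iff.2 hqrad) hs₁q
      rw [hγs₁] at h
      exact h
  have hxbar : xbar ∈ (Kerr.exterior (M i) (a i) : Set E4) := Kerr.mem_exterior.2 ((max_eq_left hrp.le).trans_lt hext)
  rcases ht2.eq_or_lt with httop | htlt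
  · -- (b) `x̄` on the top face: a recut slab point above `p₀`
    have hmem := slabmem xbar hxbar httop (by linarith) (hdomx xbar hxreg)
    rw [← hγs₁] at hmem
    exact LorentzianMetric.causalFuture_mono (singleton_subset_iff.2 hmem) hp₀s₁
  rcases hr2.eq_or_lt with hside | hrlt
  · -- (c) `x̄` on the side face `r = r₊ + δ₀`: ingredient (α) from `γ s₁`
    have hmem := hTα R' τ₁ xbar hxbar hside.ge (by linarith) (hcertKS xbar hxbar hr2 (by linarith)) htlt.le (by linarith)
      (hdomx xbar hxreg)
    rw [← hγs₁] at hmem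
    exact causalPast_trans_w7 (singleton_subset_iff.2 hmem) hp₀s₁
  -- (d) `x̄` in the open box: `γ` stays in `G` beyond `s₁` unless `s₁ = b'`, where `q` would be a box chart point
  have hxbarS : xbar ∈ Sint := ⟨hext, hrlt, by linarith, htlt⟩
  have hs₁G : γ s₁ ∈ G := ⟨xbar, hxbarS, by rw [hγs₁, hΦ' xbar hxreg]⟩
  obtain ⟨ε, hε, hball⟩ := Metric.mem_nhds_iff.1 ((hγ.continuousAt hs₁I).preimage_mem_nhds (hGo.mem_nhds hs₁G))
  rcases hs₁I.2.eq_or_lt with hsb | hsb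
  · -- `s₁ = b'`: the endpoint `q = Ψ₀ zq` is a chart point of the box
    obtain ⟨x', hx'S, hx'q⟩ := hs₁G
    rw [hsb, hγb, hΦ' x' (hsubreg (hSext hx'S)) (hdomx x' (hsubreg (hSext hx'S)))] at hx'q
    exact (hqfar x' (hSext hx'S) hx'S.2.1.le hx'S.2.2.1.le hx'S.2.2.2.le _ hx'q).elim
  · -- `s₁ < b'`: a parameter beyond `s₁` lies in `A`
    set s' : ℝ := min b' (s₁ + ε / 2) with hs'
    have hs's₁ : s₁ < s' := lt_min hsb (by linarith)
    have hs'A : s' ∈ A := by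
      refine ⟨⟨hs₁I.1.trans hs's₁.le, min_le_left _ _⟩, fun v hv ↦ ?_⟩
      rcases lt_or_ge v s₁ with hvl | hvg
      · exact (hbelow v ⟨hv.1, hvl⟩).2 v ⟨hv.1, le_rfl⟩
      · refine hball ?_
        rw [Metric.mem_ball, Real.dist_eq, abs_lt]
        constructor <;> linarith [hv.2, min_le_right b' (s₁ + ε / 2)]
    linarith [le_csSup hAbdd hs'A]

end NearHorizonBoost

end Summit.FinalStateConjecture.FinalStateConjecture.Theorems.SymplecticDualOfTheBomb

end
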